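import Mathlib
import HarnessLib
import Literature.MathematicalPhysics.QuantumFieldTheory.GaussianQuadraticMGF

/-!
# Integrability of linear-plus-quadratic exponentials under (degenerate) Gaussian measures
# (Adams–Buchholz–Kotecký–Müller (7.8); the integrability side of Lemma 7.7 (ii) / Lemma 8.4)

`GaussianQuadraticMGF.lean` computes `E_{N(0,S)}[e^{bᵀx + ½xᵀMx}]` and
`∫ e^{½((φ+ψ), A(φ+ψ))} N(0,C)(dψ)` in closed form when `1 − √S M √S` (resp. `1 − √C A √C`) is
positive definite.  For the renormalisation-group estimates (Lemma 8.4: "`w(φ + ·)` integrable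
against `μ_{k+1}`", hypotheses `hwint` of `WeightedNormDomination.integral_comp_add'`) one also needs
the INTEGRABILITY statements, which this file supplies by the same route (product Gaussian as a
density, then the image under `√S`):

* `integrable_exp_dotProduct_add_half_quadForm_stdGaussian`;
* `integrable_exp_dotProduct_add_half_quadForm_multivariateGaussian` (degenerate covariances);
* **`integrable_exp_half_quadForm_shift_multivariateGaussian`** — `ψ ↦ e^{½((φ+ψ), A(φ+ψ))}` is
  `N(0,C)`-integrable for symmetric `A` with `1 − √C A √C ≻ 0`.

Everything is proved; no named fact.

## References
* S. Adams, S. Buchholz, R. Kotecký, S. Müller, arXiv:1910.13564, Ch. 7.1 (7.8), Lemma 7.7 (ii),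
  Lemma 8.4 [AdamsBuchholzKoteckyMuller2019].
-/

noncomputable section

open MeasureTheory ProbabilityTheory WithLp Matrix
open scoped ENNReal Matrix MatrixOrder

namespace Literature.MathematicalPhysics.QuantumFieldTheory

variable {ι : Type*} [Fintype ι] [DecidableEq ι]

/-- **Integrability under the standard Gaussian**: `x ↦ e^{bᵀx + ½xᵀMx}` is integrable for
`N(0, 1)` on Euclidean `ℝ^ι` when `1 − M` is positive definite.
[cite: AdamsBuchholzKoteckyMuller2019, Ch. 7.1 (7.8) ("general Gaussian calculus")] -/
theorem integrable_exp_dotProduct_add_half_quadForm_stdGaussian {M : Matrix ι ι ℝ}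
    (hM : ((1 : Matrix ι ι ℝ) - M).PosDef) (b : ι → ℝ) :
    Integrable (fun x : EuclideanSpace ℝ ι =>
      Real.exp (b ⬝ᵥ ofLp x + (1/2 : ℝ) * (ofLp x ⬝ᵥ M *ᵥ ofLp x))) (stdGaussian (EuclideanSpace ℝ ι)) := by
  set F : (ι → ℝ) → ℝ := fun v => Real.exp (b ⬝ᵥ v + (1/2 : ℝ) * (v ⬝ᵥ M *ᵥ v)) with hF
  -- pull back to the product Gaussian on `ι → ℝ`
  rw [← map_pi_eq_stdGaussian, ← MeasurableEquiv.coe_toLp, integrable_map_equiv]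
  change Integrable F (Measure.pi fun _ : ι => gaussianReal 0 1)
  -- the product Gaussian is a density w.r.t. Lebesgue measure
  have hmeas : Measurable (fun x : ι → ℝ => ∏ i, gaussianPDF 0 1 (x i)) :=
    Finset.measurable_prod _ fun i _ => (measurable_gaussianPDF 0 1).comp (measurable_pi_apply i)
  have hfin : ∀ᵐ x ∂(volume : Measure (ι → ℝ)), (∏ i, gaussianPDF 0 1 (x i)) < ∞ :=
    Filter.Eventually.of_forall fun v => by
      rw [GaussianToolkit.prod_gaussianPDF_eq]; exact ENNReal.ofReal_lt_top
  rw [GaussianToolkit.pi_gaussianReal_eq_withDensity, integrable_withDensity_iff_integrable_smul' hmeas hfin]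
  -- `density • F = (2π)^{-|ι|/2} · (e^{bᵀv + ½vᵀMv} e^{-½ vᵀ1v})`
  have h3 : (fun v : ι → ℝ => (∏ i, gaussianPDF 0 1 (v i)).toReal • F v) =
      fun v => (Real.sqrt (2 * Real.pi))⁻¹ ^ Fintype.card ι *
        (Real.exp (b ⬝ᵥ v + (1/2 : ℝ) * (v ⬝ᵥ M *ᵥ v)) *
          Real.exp (-(1/2 : ℝ) * (v ⬝ᵥ (1 : Matrix ι ι ℝ) *ᵥ v))) := by
    funext v
    rw [GaussianToolkit.prod_gaussianPDF_eq, ENNReal.toReal_ofReal (by positivity), smul_eq_mul]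
    have hq : v ⬝ᵥ (1 : Matrix ι ι ℝ) *ᵥ v = ∑ i, v i ^ 2 := by
      rw [Matrix.one_mulVec, dotProduct]
      exact Finset.sum_congr rfl fun i _ => by ring
    rw [hq, hF]
    have : Real.exp (-(∑ i, v i ^ 2) / 2) = Real.exp (-(1/2 : ℝ) * ∑ i, v i ^ 2) := by
      congr 1; ring
    rw [this]
    ring
  rw [h3]
  exact (integrable_exp_dotProduct_add_half_quadForm_mul_gaussWeight hM b).const_mul _

/-- **Integrability under `N(0,S)`** (degenerate covariances allowed): `x ↦ e^{bᵀx + ½xᵀMx}` is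
`N(0,S)`-integrable when `1 − √S M √S` is positive definite.
[cite: AdamsBuchholzKoteckyMuller2019, Ch. 7.1 (7.8) ("general Gaussian calculus")] -/
theorem integrable_exp_dotProduct_add_half_quadForm_multivariateGaussian (S : Matrix ι ι ℝ)
    {M : Matrix ι ι ℝ} (hM : ((1 : Matrix ι ι ℝ) - CFC.sqrt S * M * CFC.sqrt S).PosDef)
    (b : ι → ℝ) :
    Integrable (fun x : EuclideanSpace ℝ ι =>
      Real.exp (b ⬝ᵥ ofLp x + (1/2 : ℝ) * (ofLp x ⬝ᵥ M *ᵥ ofLp x))) (multivariateGaussian 0 S) := by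
  set R : Matrix ι ι ℝ := CFC.sqrt S with hR
  have hRt : Rᵀ = R := GaussianToolkit.transpose_sqrt (S := S)
  have hmap : multivariateGaussian 0 S =
      (stdGaussian (EuclideanSpace ℝ ι)).map (toEuclideanCLM (n := ι) (𝕜 := ℝ) R) := by
    rw [multivariateGaussian]
    congr 1
    funext x
    rw [zero_add, ← hR]
  have hcont : Continuous fun x : EuclideanSpace ℝ ι =>
      Real.exp (b ⬝ᵥ ofLp x + (1/2 : ℝ) * (ofLp x ⬝ᵥ M *ᵥ ofLp x)) := by
    have hc : Continuous fun x : EuclideanSpace ℝ ι => (ofLp x : ι → ℝ) := PiLp.continuous_ofLp 2 _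
    refine Real.continuous_exp.comp ((continuous_const.dotProduct hc).add
      (continuous_const.mul (hc.dotProduct (continuous_const.matrix_mulVec hc))))
  rw [hmap, integrable_map_measure hcont.aestronglyMeasurable
    (toEuclideanCLM (n := ι) (𝕜 := ℝ) R).continuous.measurable.aemeasurable]
  have hcoord : (fun x : EuclideanSpace ℝ ι =>
      Real.exp (b ⬝ᵥ ofLp x + (1/2 : ℝ) * (ofLp x ⬝ᵥ M *ᵥ ofLp x))) ∘
        (toEuclideanCLM (n := ι) (𝕜 := ℝ) R) =
      fun z => Real.exp ((R *ᵥ b) ⬝ᵥ ofLp z + (1/2 : ℝ) * (ofLp z ⬝ᵥ (R * M * R) *ᵥ ofLp z)) := by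
    funext z
    simp only [Function.comp_apply]
    rw [ofLp_toEuclideanCLM, mulVec_dotProduct_mulVec_mulVec, hRt,
      dotProduct_mulVec_eq_transpose_mulVec_dotProduct, hRt]
  rw [hcoord]
  exact integrable_exp_dotProduct_add_half_quadForm_stdGaussian (M := R * M * R) hM (R *ᵥ b)

/-- **Integrability of the shifted quadratic weight under `N(0,C)`** (the hypothesis "`w(φ+·)` is
`μ_{k+1}`-integrable" of Lemma 8.4 for the weights `e^{½(φ,Aφ)}` of Ch. 7): for symmetric `A` with
`1 − √C A √C ≻ 0` and every `φ`. [cite: AdamsBuchholzKoteckyMuller2019, Lemma 8.4] -/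
theorem integrable_exp_half_quadForm_shift_multivariateGaussian (C : Matrix ι ι ℝ)
    {A : Matrix ι ι ℝ} (hA : A.IsSymm)
    (hCA : ((1 : Matrix ι ι ℝ) - CFC.sqrt C * A * CFC.sqrt C).PosDef) (φ : ι → ℝ) :
    Integrable (fun ψ : EuclideanSpace ℝ ι =>
      Real.exp ((1/2 : ℝ) * ((φ + ofLp ψ) ⬝ᵥ A *ᵥ (φ + ofLp ψ)))) (multivariateGaussian 0 C) := by
  have hAt : Aᵀ = A := hA
  have hexp : (fun ψ : EuclideanSpace ℝ ι =>
      Real.exp ((1/2 : ℝ) * ((φ + ofLp ψ) ⬝ᵥ A *ᵥ (φ + ofLp ψ)))) =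
      fun ψ => Real.exp ((1/2 : ℝ) * (φ ⬝ᵥ A *ᵥ φ)) *
        Real.exp ((A *ᵥ φ) ⬝ᵥ ofLp ψ + (1/2 : ℝ) * (ofLp ψ ⬝ᵥ A *ᵥ ofLp ψ)) := by
    funext ψ
    rw [← Real.exp_add]
    congr 1
    have hcross : ofLp ψ ⬝ᵥ A *ᵥ φ = (A *ᵥ φ) ⬝ᵥ ofLp ψ := dotProduct_comm _ _
    have hcross' : φ ⬝ᵥ A *ᵥ ofLp ψ = (A *ᵥ φ) ⬝ᵥ ofLp ψ := by
      rw [dotProduct_mulVec_eq_transpose_mulVec_dotProduct, hAt]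
    rw [Matrix.mulVec_add, add_dotProduct, dotProduct_add, dotProduct_add, hcross, hcross']
    ring
  rw [hexp]
  exact (integrable_exp_dotProduct_add_half_quadForm_multivariateGaussian C hCA (A *ᵥ φ)).const_mul _

end Literature.MathematicalPhysics.QuantumFieldTheory

end
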